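import Summits.Ventures.LatticeQCDFlow.Scoring.SU2TorusWilsonLoops
import Summits.Ventures.LatticeQCDFlow.Scoring.SU2TorusPlaquetteLimit
import HarnessLib

/-!
# SU(2) on the 2-torus: the EXACT AREA LAW — `⟨½ tr W_{R×T}⟩_{(ℤ/L)²,β} = (I₂(2β)/I₁(2β))^{RT}` up to `O((I₂/I₁)^{L²−RT})`

HONEST FRAMING: exact (Metropolis-corrected) sampling algorithms for lattice gauge theory;
figures of merit are autocorrelation/cost numbers at stated couplings and volumes; no
continuum-physics claim.

Venture `LatticeQCDFlow` (cell pub-lqcd), sub-topic `Scoring`; FANOUT row 5 (`s0-sun-a`), GEN-11.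
NEW WORK of the cell (placement rule).  `SU2TorusWilsonLoops.wilson_mean_su2a0_loop_two` gives the exact
`R × T` Wilson loop of the `L × L` torus as a ratio of two series in `w_n = c_n/(n+1) = e^{−2β}I_{n+1}(2β)/β`.
Both series are dominated by their `n = 0` terms, whose ratio is the infinite-volume AREA LAW
`(w_1/w_0)^{RT} = (I₂(2β)/I₁(2β))^{RT}` (oracle X02's `(λ_f/λ_0)^A` column) up to an exponentially small
volume correction:

* `abs_div_tsum_sub_pow_le` — the abstract estimate: for an antitone, positive, summable `w : ℕ → ℝ`
  and exponents `A = a+1`, `B = b+1`, `V = A + B`: with `Z = Σ_n w_n^V` and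
  `N = ½ Σ_n [w_n^A (n+1) w_{n+1}^B/(n+2) + w_{n+1}^A (n+2) w_n^B/(n+1)]`,
  `|N/Z − (w_1/w_0)^A| ≤ (w_1/w_0)^B · (¼ + (5/2)·(Σ_n w_{n+1})/w_0)`;
* **`abs_wilson_mean_su2a0_loop_two_sub_le`** — for `β > 0`, `1 ≤ R ≤ L−1`, `1 ≤ T ≤ L−1` and every corner:
  `|⟨½ tr W_{R×T}⟩_{(ℤ/L)²,β} − (I₂(2β)/I₁(2β))^{RT}| ≤ (I₂(2β)/I₁(2β))^{L²−RT}·(¼ + (5/2)·Σ_n I_{n+2}(2β)/I₁(2β))`;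
* **`tendsto_wilson_mean_su2a0_loop_two`** — THE THERMODYNAMIC LIMIT: for `β > 0` and fixed `R, T ≥ 1`,
  `⟨½ tr W_{R×T}⟩_{(ℤ/L)²,β} → (I₂(2β)/I₁(2β))^{RT}` as `L → ∞`: the two-dimensional SU(2) lattice
  Yang–Mills Wilson loops obey an exact area law with string tension `−log(I₂(2β)/I₁(2β))` per plaquette.

Elementary real analysis on the typed series (the `A = 1` case is GEN-10's
`SU2TorusPlaquetteFiniteVolume`); nothing is cited; no `def`.
-/

noncomputable section

open Real MeasureTheory Set Function Finset Filter Topology Polynomial.Chebyshev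
open Literature.MathematicalPhysics.QuantumFieldTheory Literature.MathematicalPhysics.QuantumLattice
open Literature.Analysis.FunctionSpaces
open Summit.Ventures.LatticeQCDFlow.Exactness
open Summit.Ventures.LatticeQCDFlow.Theory2.Lattice

namespace Summit.Ventures.LatticeQCDFlow.Scoring

/-! ## §1. The abstract two-series estimate with an area exponent -/

section Abstract

variable {w : ℕ → ℝ} (hanti : Antitone w) (hpos : ∀ n, 0 < w n) (hsum : Summable w)
include hanti hpos hsum

omit hsum in
/-- A product of `A + B` factors `≤ w_1`, one of which is `w_m` (`m ≥ 1`), is at most `w_1^{A+B−1} w_m`: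
here `w_m^{a+1} w_k^{b+1} ≤ w_1^{a+b+1} w_m` for `1 ≤ m` and `1 ≤ k`. -/
theorem pow_mul_pow_le_of_antitone {m k : ℕ} (hm : 1 ≤ m) (hk : 1 ≤ k) (a b : ℕ) :
    w m ^ (a + 1) * w k ^ (b + 1) ≤ w 1 ^ (a + b + 1) * w m := by
  have hwm := hpos m
  have hwk := hpos k
  have hw1 := hpos 1
  have h1 : w m ^ a ≤ w 1 ^ a := pow_le_pow_left₀ hwm.le (hanti hm) a
  have h2 : w k ^ (b + 1) ≤ w 1 ^ (b + 1) := pow_le_pow_left₀ hwk.le (hanti hk) (b + 1)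
  calc w m ^ (a + 1) * w k ^ (b + 1) = w m * (w m ^ a * w k ^ (b + 1)) := by ring
    _ ≤ w m * (w 1 ^ a * w 1 ^ (b + 1)) :=
        mul_le_mul_of_nonneg_left (mul_le_mul h1 h2 (by positivity) (by positivity)) hwm.le
    _ = w 1 ^ (a + b + 1) * w m := by ring

/-- The numerator terms are summable. -/
theorem summable_loopNumTerm (a b : ℕ) :
    Summable fun n : ℕ => (1 / 2 : ℝ) * (w n ^ (a + 1) * ((n : ℝ) + 1) * w (n + 1) ^ (b + 1) / ((n : ℝ) + 2) +
      w (n + 1) ^ (a + 1) * ((n : ℝ) + 2) * w n ^ (b + 1) / ((n : ℝ) + 1)) := by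
  have hb : ∀ n : ℕ, (1 / 2 : ℝ) * (w n ^ (a + 1) * ((n : ℝ) + 1) * w (n + 1) ^ (b + 1) / ((n : ℝ) + 2) +
      w (n + 1) ^ (a + 1) * ((n : ℝ) + 2) * w n ^ (b + 1) / ((n : ℝ) + 1)) ≤
      (1 / 2 : ℝ) * (w 0 ^ (a + b + 1) * w n + 2 * (w 0 ^ (a + b + 1) * w n)) := by
    intro n
    have hwn := hpos n
    have hwn1 := hpos (n + 1)
    have hw0 := hpos 0
    have h1 : ((n : ℝ) + 1) / ((n : ℝ) + 2) ≤ 1 := by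
      rw [div_le_one (by positivity)]; linarith
    have h2 : ((n : ℝ) + 2) / ((n : ℝ) + 1) ≤ 2 := by
      rw [div_le_iff₀ (by positivity)]; linarith
    have hpa : w n ^ a ≤ w 0 ^ a := pow_le_pow_left₀ hwn.le (hanti (Nat.zero_le _)) _
    have hpb : w (n + 1) ^ (b + 1) ≤ w 0 ^ (b + 1) := pow_le_pow_left₀ hwn1.le (hanti (Nat.zero_le _)) _
    have hpa' : w (n + 1) ^ (a + 1) ≤ w 0 ^ (a + 1) := pow_le_pow_left₀ hwn1.le (hanti (Nat.zero_le _)) _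
    have hpb' : w n ^ b ≤ w 0 ^ b := pow_le_pow_left₀ hwn.le (hanti (Nat.zero_le _)) _
    have hA : w n ^ (a + 1) * ((n : ℝ) + 1) * w (n + 1) ^ (b + 1) / ((n : ℝ) + 2) ≤
        w 0 ^ (a + b + 1) * w n := by
      have : w n ^ (a + 1) * ((n : ℝ) + 1) * w (n + 1) ^ (b + 1) / ((n : ℝ) + 2) =
          ((n : ℝ) + 1) / ((n : ℝ) + 2) * (w n * (w n ^ a * w (n + 1) ^ (b + 1))) := by ring
      rw [this]
      calc _ ≤ 1 * (w n * (w n ^ a * w (n + 1) ^ (b + 1))) :=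
            mul_le_mul_of_nonneg_right h1 (by positivity)
        _ ≤ 1 * (w n * (w 0 ^ a * w 0 ^ (b + 1))) := by
            refine mul_le_mul_of_nonneg_left (mul_le_mul_of_nonneg_left
              (mul_le_mul hpa hpb (by positivity) (by positivity)) hwn.le) (by norm_num)
        _ = w 0 ^ (a + b + 1) * w n := by ring
    have hB : w (n + 1) ^ (a + 1) * ((n : ℝ) + 2) * w n ^ (b + 1) / ((n : ℝ) + 1) ≤
        2 * (w 0 ^ (a + b + 1) * w n) := by
      have : w (n + 1) ^ (a + 1) * ((n : ℝ) + 2) * w n ^ (b + 1) / ((n : ℝ) + 1) =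
          ((n : ℝ) + 2) / ((n : ℝ) + 1) * (w n * (w (n + 1) ^ (a + 1) * w n ^ b)) := by ring
      rw [this]
      calc _ ≤ 2 * (w n * (w (n + 1) ^ (a + 1) * w n ^ b)) :=
            mul_le_mul_of_nonneg_right h2 (by positivity)
        _ ≤ 2 * (w n * (w 0 ^ (a + 1) * w 0 ^ b)) := by
            refine mul_le_mul_of_nonneg_left (mul_le_mul_of_nonneg_left
              (mul_le_mul hpa' hpb' (by positivity) (by positivity)) hwn.le) (by norm_num)
        _ = 2 * (w 0 ^ (a + b + 1) * w n) := by ring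
    linarith
  refine Summable.of_nonneg_of_le (fun n => ?_) hb ?_
  · have := (hpos n).le; have := (hpos (n + 1)).le; positivity
  · exact ((hsum.mul_left _).add ((hsum.mul_left _).mul_left 2)).mul_left _

/-- **The abstract two-series estimate with an area exponent.**  For an antitone, positive, summable
`w : ℕ → ℝ` and `A = a+1`, `B = b+1`: with `Z = Σ_n w_n^{A+B}` and
`N = ½ Σ_n [w_n^A (n+1) w_{n+1}^B/(n+2) + w_{n+1}^A (n+2) w_n^B/(n+1)]`,
`|N/Z − (w_1/w_0)^A| ≤ (w_1/w_0)^B · (¼ + (5/2)·(Σ_n w_{n+1})/w_0)`. -/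
theorem abs_div_tsum_sub_pow_le (a b : ℕ) :
    |(∑' n : ℕ, (1 / 2 : ℝ) * (w n ^ (a + 1) * ((n : ℝ) + 1) * w (n + 1) ^ (b + 1) / ((n : ℝ) + 2) +
        w (n + 1) ^ (a + 1) * ((n : ℝ) + 2) * w n ^ (b + 1) / ((n : ℝ) + 1))) /
        (∑' n : ℕ, w n ^ (a + b + 2)) - (w 1 / w 0) ^ (a + 1)| ≤
      (w 1 / w 0) ^ (b + 1) * (1 / 4 + 5 / 2 * (∑' n : ℕ, w (n + 1)) / w 0) := by
  set N : ℝ := ∑' n : ℕ, (1 / 2 : ℝ) * (w n ^ (a + 1) * ((n : ℝ) + 1) * w (n + 1) ^ (b + 1) / ((n : ℝ) + 2) +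
    w (n + 1) ^ (a + 1) * ((n : ℝ) + 2) * w n ^ (b + 1) / ((n : ℝ) + 1)) with hN
  set Z : ℝ := ∑' n : ℕ, w n ^ (a + b + 2) with hZ
  set S : ℝ := ∑' n : ℕ, w (n + 1) with hS
  set r : ℝ := w 1 / w 0 with hr
  have hw0 := hpos 0
  have hw1 := hpos 1
  have hS0 : 0 ≤ S := tsum_nonneg fun n => (hpos _).le
  have hr0 : 0 ≤ r := by positivity
  have hr1 : r ≤ 1 := (div_le_one hw0).mpr (hanti (by norm_num))
  have hsumZ : Summable fun n => w n ^ (a + b + 2) := summable_pow_of_antitone hanti hpos hsum _ (by omega)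
  have hsumN := summable_loopNumTerm hanti hpos hsum a b
  have hsumS : Summable fun n => w (n + 1) := (summable_nat_add_iff 1).mpr hsum
  have hZge : w 0 ^ (a + b + 2) ≤ Z := hsumZ.le_tsum 0 (fun j _ => pow_nonneg (hpos j).le _)
  have hZpos : 0 < Z := lt_of_lt_of_le (pow_pos hw0 _) hZge
  -- the difference as one series
  set D : ℕ → ℝ := fun n => (1 / 2 : ℝ) * (w n ^ (a + 1) * ((n : ℝ) + 1) * w (n + 1) ^ (b + 1) / ((n : ℝ) + 2) +
    w (n + 1) ^ (a + 1) * ((n : ℝ) + 2) * w n ^ (b + 1) / ((n : ℝ) + 1)) - r ^ (a + 1) * w n ^ (a + b + 2)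
    with hD
  have hsumD : Summable D := hsumN.sub (hsumZ.mul_left _)
  have hdiff : N - r ^ (a + 1) * Z = ∑' n, D n := by
    rw [hN, hZ, ← tsum_mul_left, ← hsumN.tsum_sub (hsumZ.mul_left _)]
  have hD0 : D 0 = 1 / 4 * (w 0 ^ (a + 1) * w 1 ^ (b + 1)) := by
    rw [hD, hr]
    simp only [Nat.cast_zero, zero_add]
    rw [div_pow]
    have hw00 : w 0 ≠ 0 := hw0.ne'
    have hw0p : w 0 ^ (a + 1) ≠ 0 := by positivity
    field_simp
    ring
  have hDtail : ∀ n, |D (n + 1)| ≤ 5 / 2 * (w 1 ^ (a + b + 1) * w (n + 1)) := by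
    intro n
    have hwn1 := hpos (n + 1)
    have hwn2 := hpos (n + 1 + 1)
    have h1 : (((n + 1 : ℕ) : ℝ) + 1) / (((n + 1 : ℕ) : ℝ) + 2) ≤ 1 := by
      rw [div_le_one (by positivity)]; linarith
    have h2 : (((n + 1 : ℕ) : ℝ) + 2) / (((n + 1 : ℕ) : ℝ) + 1) ≤ 2 := by
      rw [div_le_iff₀ (by positivity)]; push_cast; linarith
    -- the three products are at most `w_1^{a+b+1} w_{n+1}`
    have hP1 : w (n + 1) ^ (a + 1) * w (n + 1 + 1) ^ (b + 1) ≤ w 1 ^ (a + b + 1) * w (n + 1) :=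
      pow_mul_pow_le_of_antitone hanti hpos (by omega) (by omega) a b
    have hP2 : w (n + 1 + 1) ^ (a + 1) * w (n + 1) ^ (b + 1) ≤ w 1 ^ (a + b + 1) * w (n + 1) := by
      have h := pow_mul_pow_le_of_antitone hanti hpos (m := n + 1) (k := n + 1 + 1)
        (by omega) (by omega) b a
      have hm : w (n + 1 + 1) ^ (a + 1) ≤ w (n + 1) ^ (a + 1) :=
        pow_le_pow_left₀ hwn2.le (hanti (by omega)) _
      have hk : w (n + 1) ^ (b + 1) ≤ w (n + 1) ^ (b + 1) := le_rfl
      calc w (n + 1 + 1) ^ (a + 1) * w (n + 1) ^ (b + 1)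
          ≤ w (n + 1) ^ (a + 1) * w (n + 1) ^ (b + 1) := mul_le_mul_of_nonneg_right hm (by positivity)
        _ = w (n + 1) ^ (b + 1) * w (n + 1) ^ (a + 1) := mul_comm _ _
        _ ≤ w 1 ^ (b + a + 1) * w (n + 1) :=
            pow_mul_pow_le_of_antitone hanti hpos (by omega) (by omega) b a
        _ = w 1 ^ (a + b + 1) * w (n + 1) := by rw [Nat.add_comm b a]
    have hP3 : r ^ (a + 1) * w (n + 1) ^ (a + b + 2) ≤ w 1 ^ (a + b + 1) * w (n + 1) := by
      have hq : w (n + 1) ^ (a + b + 1) ≤ w 1 ^ (a + b + 1) := pow_le_pow_left₀ hwn1.le (hanti (by omega)) _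
      calc r ^ (a + 1) * w (n + 1) ^ (a + b + 2) ≤ 1 * w (n + 1) ^ (a + b + 2) :=
            mul_le_mul_of_nonneg_right (pow_le_one₀ hr0 hr1) (by positivity)
        _ = w (n + 1) ^ (a + b + 1) * w (n + 1) := by rw [one_mul, pow_succ]
        _ ≤ w 1 ^ (a + b + 1) * w (n + 1) := mul_le_mul_of_nonneg_right hq hwn1.le
    have hA : 0 ≤ w (n + 1) ^ (a + 1) * (((n + 1 : ℕ) : ℝ) + 1) * w (n + 1 + 1) ^ (b + 1) /
        (((n + 1 : ℕ) : ℝ) + 2) := by positivity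
    have hB : 0 ≤ w (n + 1 + 1) ^ (a + 1) * (((n + 1 : ℕ) : ℝ) + 2) * w (n + 1) ^ (b + 1) /
        (((n + 1 : ℕ) : ℝ) + 1) := by positivity
    have hC : 0 ≤ r ^ (a + 1) * w (n + 1) ^ (a + b + 2) := by positivity
    have hA' : w (n + 1) ^ (a + 1) * (((n + 1 : ℕ) : ℝ) + 1) * w (n + 1 + 1) ^ (b + 1) /
        (((n + 1 : ℕ) : ℝ) + 2) ≤ w 1 ^ (a + b + 1) * w (n + 1) := by
      have : w (n + 1) ^ (a + 1) * (((n + 1 : ℕ) : ℝ) + 1) * w (n + 1 + 1) ^ (b + 1) /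
          (((n + 1 : ℕ) : ℝ) + 2) = (((n + 1 : ℕ) : ℝ) + 1) / (((n + 1 : ℕ) : ℝ) + 2) *
          (w (n + 1) ^ (a + 1) * w (n + 1 + 1) ^ (b + 1)) := by ring
      rw [this]
      calc _ ≤ 1 * (w (n + 1) ^ (a + 1) * w (n + 1 + 1) ^ (b + 1)) :=
            mul_le_mul_of_nonneg_right h1 (by positivity)
        _ ≤ w 1 ^ (a + b + 1) * w (n + 1) := by rw [one_mul]; exact hP1
    have hB' : w (n + 1 + 1) ^ (a + 1) * (((n + 1 : ℕ) : ℝ) + 2) * w (n + 1) ^ (b + 1) /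
        (((n + 1 : ℕ) : ℝ) + 1) ≤ 2 * (w 1 ^ (a + b + 1) * w (n + 1)) := by
      have : w (n + 1 + 1) ^ (a + 1) * (((n + 1 : ℕ) : ℝ) + 2) * w (n + 1) ^ (b + 1) /
          (((n + 1 : ℕ) : ℝ) + 1) = (((n + 1 : ℕ) : ℝ) + 2) / (((n + 1 : ℕ) : ℝ) + 1) *
          (w (n + 1 + 1) ^ (a + 1) * w (n + 1) ^ (b + 1)) := by ring
      rw [this]
      calc _ ≤ 2 * (w (n + 1 + 1) ^ (a + 1) * w (n + 1) ^ (b + 1)) :=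
            mul_le_mul_of_nonneg_right h2 (by positivity)
        _ ≤ 2 * (w 1 ^ (a + b + 1) * w (n + 1)) := mul_le_mul_of_nonneg_left hP2 (by norm_num)
    rw [hD]
    simp only
    rw [abs_le]
    constructor <;> nlinarith
  -- `|N − r^A Z| ≤ w_1^{a+b+1} (¼ w_0 … )`: the head term and the tail
  have hsumDtail : Summable fun n => D (n + 1) := (summable_nat_add_iff 1).mpr hsumD
  have habs : |N - r ^ (a + 1) * Z| ≤ 1 / 4 * (w 0 ^ (a + 1) * w 1 ^ (b + 1)) + 5 / 2 * (w 1 ^ (a + b + 1) * S) := by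
    rw [hdiff, hsumD.tsum_eq_zero_add, hD0]
    have htail : |∑' n, D (n + 1)| ≤ ∑' n, 5 / 2 * (w 1 ^ (a + b + 1) * w (n + 1)) := by
      have h1 : ‖∑' n, D (n + 1)‖ ≤ ∑' n, ‖D (n + 1)‖ := norm_tsum_le_tsum_norm hsumDtail.norm
      simp only [Real.norm_eq_abs] at h1
      exact h1.trans (hsumDtail.abs.tsum_le_tsum hDtail ((hsumS.mul_left _).mul_left _))
    rw [tsum_mul_left, tsum_mul_left, ← hS] at htail
    have h0 : 0 ≤ 1 / 4 * (w 0 ^ (a + 1) * w 1 ^ (b + 1)) := by positivity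
    calc |1 / 4 * (w 0 ^ (a + 1) * w 1 ^ (b + 1)) + ∑' n, D (n + 1)|
        ≤ |1 / 4 * (w 0 ^ (a + 1) * w 1 ^ (b + 1))| + |∑' n, D (n + 1)| := abs_add_le _ _
      _ ≤ _ := by rw [abs_of_nonneg h0]; exact add_le_add le_rfl htail
  -- divide by `Z ≥ w_0^{a+b+2}` and compare exponents
  have hZ0 : Z ≠ 0 := hZpos.ne'
  have hw00 : w 0 ≠ 0 := hw0.ne'
  have hkey : N / Z - r ^ (a + 1) = (N - r ^ (a + 1) * Z) / Z := by field_simp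
  rw [hkey, abs_div, abs_of_pos hZpos, div_le_iff₀ hZpos]
  have hK : 0 ≤ r ^ (b + 1) * (1 / 4 + 5 / 2 * S / w 0) := by
    have : 0 ≤ 5 / 2 * S / w 0 := by positivity
    positivity
  -- the head: `¼ w_0^{a+1} w_1^{b+1} = ¼ r^{b+1} w_0^{a+b+2}`
  have hhead : 1 / 4 * (w 0 ^ (a + 1) * w 1 ^ (b + 1)) = r ^ (b + 1) * (1 / 4) * w 0 ^ (a + b + 2) := by
    rw [hr, div_pow]
    have : w 0 ^ (b + 1) ≠ 0 := by positivity
    field_simp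
    ring
  -- the tail: `w_1^{a+b+1} = r^{a+b+1} w_0^{a+b+1} ≤ r^{b+1} w_0^{a+b+1}`
  have htail' : 5 / 2 * (w 1 ^ (a + b + 1) * S) ≤ r ^ (b + 1) * (5 / 2 * S / w 0) * w 0 ^ (a + b + 2) := by
    have hra : r ^ (a + b + 1) ≤ r ^ (b + 1) := pow_le_pow_of_le_one hr0 hr1 (by omega)
    have hw1e : w 1 ^ (a + b + 1) = r ^ (a + b + 1) * w 0 ^ (a + b + 1) := by
      rw [hr, div_pow, div_mul_cancel₀]
      positivity
    have heq : r ^ (b + 1) * (5 / 2 * S / w 0) * w 0 ^ (a + b + 2) =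
        5 / 2 * (r ^ (b + 1) * w 0 ^ (a + b + 1) * S) := by
      rw [pow_succ (w 0) (a + b + 1)]
      field_simp
    rw [heq, hw1e]
    have : r ^ (a + b + 1) * w 0 ^ (a + b + 1) * S ≤ r ^ (b + 1) * w 0 ^ (a + b + 1) * S :=
      mul_le_mul_of_nonneg_right (mul_le_mul_of_nonneg_right hra (by positivity)) hS0
    nlinarith
  calc |N - r ^ (a + 1) * Z|
      ≤ 1 / 4 * (w 0 ^ (a + 1) * w 1 ^ (b + 1)) + 5 / 2 * (w 1 ^ (a + b + 1) * S) := habs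
    _ ≤ r ^ (b + 1) * (1 / 4) * w 0 ^ (a + b + 2) + r ^ (b + 1) * (5 / 2 * S / w 0) * w 0 ^ (a + b + 2) := by
        rw [hhead]; exact add_le_add le_rfl htail'
    _ = r ^ (b + 1) * (1 / 4 + 5 / 2 * S / w 0) * w 0 ^ (a + b + 2) := by ring
    _ ≤ r ^ (b + 1) * (1 / 4 + 5 / 2 * S / w 0) * Z := mul_le_mul_of_nonneg_left hZge hK

end Abstract

/-! ## §2. The SU(2) torus Wilson loops: exponentially small finite-volume correction to the area law -/

/-- **THE FINITE-VOLUME CORRECTION TO THE AREA LAW IS EXPONENTIALLY SMALL.**  For `β > 0`, a corner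
`(i,j)` and `1 ≤ R ≤ L − 1`, `1 ≤ T ≤ L − 1`:
`|⟨½ tr W_{R×T}⟩_{(ℤ/L)²,β} − (I₂(2β)/I₁(2β))^{RT}| ≤ (I₂(2β)/I₁(2β))^{L²−RT}·(¼ + (5/2)·Σ_n I_{n+2}(2β)/I₁(2β))`. -/
theorem abs_wilson_mean_su2a0_loop_two_sub_le {L : ℕ} [NeZero L] {β : ℝ} (hβ : 0 < β) (i j : ZMod L)
    {R T : ℕ} (hR : 1 ≤ R) (hRL : R + 1 ≤ L) (hT : 1 ≤ T) (hTL : T + 1 ≤ L) :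
    |∫ V, su2a0 (((List.range R).map fun a : ℕ => V (![i + a, j], 0)).prod *
            ((List.range T).map fun b : ℕ => V (![i + R, j + b], 1)).prod *
            (((List.range R).map fun a : ℕ => V (![i + a, j + T], 0)).prod)⁻¹ *
            (((List.range T).map fun b : ℕ => V (![i, j + b], 1)).prod)⁻¹)
        ∂(wilsonMeasure (d := 2) (L := L) (fundamentalRep (Fin 2)) β) -
        (besselI 2 (2 * β) / besselI 1 (2 * β)) ^ (R * T)| ≤
      (besselI 2 (2 * β) / besselI 1 (2 * β)) ^ (L ^ 2 - R * T) *
        (1 / 4 + 5 / 2 * (∑' n : ℕ, besselI (n + 2) (2 * β)) / besselI 1 (2 * β)) := by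
  set w : ℕ → ℝ := fun n => Real.exp (-(2 * β)) * (besselI n (2 * β) - besselI (n + 2) (2 * β)) /
    ((n : ℝ) + 1) with hw
  have hanti : Antitone w := charCoeff_div_succ_antitone hβ
  have hpos : ∀ n, 0 < w n := charCoeff_div_succ_pos hβ
  have hsum : Summable w := summable_charCoeff_div_succ hβ.le
  -- exponents: `RT = a + 1`, `L² − RT = b + 1`
  have hRT : 1 ≤ R * T := Nat.mul_pos hR hT
  have hRTL : R * T + 1 ≤ L ^ 2 := by
    have : R * T ≤ (L - 1) * (L - 1) := Nat.mul_le_mul (by omega) (by omega)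
    have h2 : (L - 1) * (L - 1) + 1 ≤ L * L := by
      obtain ⟨L', hL'⟩ : ∃ L', L = L' + 1 := ⟨L - 1, by omega⟩
      subst hL'
      simp only [Nat.add_sub_cancel]
      nlinarith
    rw [sq]; omega
  obtain ⟨a, ha⟩ : ∃ a, R * T = a + 1 := ⟨R * T - 1, by omega⟩
  obtain ⟨b, hb⟩ : ∃ b, L ^ 2 - R * T = b + 1 := ⟨L ^ 2 - R * T - 1, by omega⟩
  have hV : L ^ 2 = a + b + 2 := by omega
  have habs := abs_div_tsum_sub_pow_le hanti hpos hsum a b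
  -- identify the series
  have hw' : ∀ n, w n = Real.exp (-(2 * β)) * besselI (n + 1) (2 * β) / β := fun n =>
    charCoeff_div_succ_eq_besselI n hβ.ne'
  have hI1 : 0 < besselI 1 (2 * β) := besselI_pos 1 (by linarith)
  have he : 0 < Real.exp (-(2 * β)) := Real.exp_pos _
  have hratio : w 1 / w 0 = besselI 2 (2 * β) / besselI 1 (2 * β) := by
    rw [hw' 1, hw' 0]
    field_simp
  have hS : 5 / 2 * (∑' n : ℕ, w (n + 1)) / w 0 =
      5 / 2 * (∑' n : ℕ, besselI (n + 2) (2 * β)) / besselI 1 (2 * β) := by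
    have h1 : (fun n : ℕ => w (n + 1)) = fun n => (Real.exp (-(2 * β)) / β) * besselI (n + 2) (2 * β) := by
      funext n; rw [hw' (n + 1)]; ring
    rw [h1, tsum_mul_left, hw' 0]
    field_simp
  have hw1 : ∀ n : ℕ, Real.exp (-(2 * β)) * (besselI (n + 1) (2 * β) - besselI (n + 1 + 2) (2 * β)) /
      ((n : ℝ) + 2) = w (n + 1) := by
    intro n
    rw [hw]
    push_cast
    ring_nf
  have hnum : ∀ n : ℕ, (1 / 2 : ℝ) *
      ((Real.exp (-(2 * β)) * (besselI n (2 * β) - besselI (n + 2) (2 * β)) / ((n : ℝ) + 1)) ^ (R * T) *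
          ((n : ℝ) + 1) *
          (Real.exp (-(2 * β)) * (besselI (n + 1) (2 * β) - besselI (n + 1 + 2) (2 * β)) / ((n : ℝ) + 2)) ^
            (L ^ 2 - R * T) / ((n : ℝ) + 2) +
        (Real.exp (-(2 * β)) * (besselI (n + 1) (2 * β) - besselI (n + 1 + 2) (2 * β)) / ((n : ℝ) + 2)) ^
            (R * T) * ((n : ℝ) + 2) *
          (Real.exp (-(2 * β)) * (besselI n (2 * β) - besselI (n + 2) (2 * β)) / ((n : ℝ) + 1)) ^
            (L ^ 2 - R * T) / ((n : ℝ) + 1)) =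
      (1 / 2 : ℝ) * (w n ^ (a + 1) * ((n : ℝ) + 1) * w (n + 1) ^ (b + 1) / ((n : ℝ) + 2) +
        w (n + 1) ^ (a + 1) * ((n : ℝ) + 2) * w n ^ (b + 1) / ((n : ℝ) + 1)) := by
    intro n
    rw [hw1 n, hb, ha]
  have hden : ∀ n : ℕ, (Real.exp (-(2 * β)) * (besselI n (2 * β) - besselI (n + 2) (2 * β)) /
      ((n : ℝ) + 1)) ^ (L ^ 2) = w n ^ (a + b + 2) := fun n => by rw [hV]
  rw [wilson_mean_su2a0_loop_two hβ.le i j hR (by omega) hT (by omega), tsum_congr hnum, tsum_congr hden,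
    ← hratio, ← hS, hb, ha]
  exact habs

/-- **THE EXACT AREA LAW IN THE THERMODYNAMIC LIMIT.**  For `β > 0`, a fixed loop size `R, T ≥ 1`
(corner at the origin) and the tori `(ℤ/(L+R+T+1))²`, `L → ∞`:
`⟨½ tr W_{R×T}⟩ → (I₂(2β)/I₁(2β))^{RT}` — the Wilson loops of two-dimensional SU(2) lattice Yang–Mills
obey an exact area law with string tension `−log(I₂(2β)/I₁(2β))` per plaquette. -/
theorem tendsto_wilson_mean_su2a0_loop_two {β : ℝ} (hβ : 0 < β) {R T : ℕ} (hR : 1 ≤ R) (hT : 1 ≤ T) :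
    Tendsto (fun L : ℕ => ∫ V, su2a0
        (((List.range R).map fun a : ℕ => V (![(0 : ZMod (L + R + T + 1)) + a, 0], 0)).prod *
          ((List.range T).map fun b : ℕ => V (![(0 : ZMod (L + R + T + 1)) + R, 0 + b], 1)).prod *
          (((List.range R).map fun a : ℕ => V (![(0 : ZMod (L + R + T + 1)) + a, 0 + T], 0)).prod)⁻¹ *
          (((List.range T).map fun b : ℕ => V (![(0 : ZMod (L + R + T + 1)), 0 + b], 1)).prod)⁻¹)
        ∂(wilsonMeasure (d := 2) (L := L + R + T + 1) (fundamentalRep (Fin 2)) β))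
      atTop (𝓝 ((besselI 2 (2 * β) / besselI 1 (2 * β)) ^ (R * T))) := by
  obtain ⟨hr0, hr1⟩ := besselI_two_div_one_lt_one hβ
  set r : ℝ := besselI 2 (2 * β) / besselI 1 (2 * β) with hr
  set K : ℝ := 1 / 4 + 5 / 2 * (∑' n : ℕ, besselI (n + 2) (2 * β)) / besselI 1 (2 * β) with hK
  have hexp : Tendsto (fun L : ℕ => (L + R + T + 1) ^ 2 - R * T) atTop atTop := by
    refine tendsto_atTop_mono (fun L => ?_) tendsto_id
    have h1 : R * T ≤ (L + R + T + 1) * (L + R + T + 1) := by nlinarith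
    have h2 : L ≤ (L + R + T + 1) * (L + R + T + 1) - R * T := by
      have : L + R * T ≤ (L + R + T + 1) * (L + R + T + 1) := by nlinarith
      omega
    simpa [sq] using h2
  have hpow : Tendsto (fun L : ℕ => r ^ ((L + R + T + 1) ^ 2 - R * T)) atTop (𝓝 0) :=
    (tendsto_pow_atTop_nhds_zero_of_lt_one hr0 hr1).comp hexp
  have hbound : Tendsto (fun L : ℕ => r ^ ((L + R + T + 1) ^ 2 - R * T) * K) atTop (𝓝 0) := by
    simpa using hpow.mul_const K
  rw [tendsto_iff_norm_sub_tendsto_zero]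
  refine squeeze_zero (fun L => norm_nonneg _) (fun L => ?_) hbound
  rw [Real.norm_eq_abs]
  exact abs_wilson_mean_su2a0_loop_two_sub_le (L := L + R + T + 1) hβ 0 0 hR (by omega) hT (by omega)

end Summit.Ventures.LatticeQCDFlow.Scoring
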